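import Mathlib
import Literature.RingTheory.KrullDimension.AffineDimension
import Literature.AlgebraicGeometry.Resolution.RegularLocalRingsProofs

/-!
# `SeparableGalois.GaloisQuotientModels`, line `Sketch`, stub `stub_ferocify`
# (card `ferocious-enlargement`, first lemma): the ferocified Artin–Schreier layer is regular

Registered stub `FerociousEnlargement.stub_ferocify` of crux stmt-ResolutionOfSingularities-18955
(`Cruxes/GaloisQuotientModels/SketchIdeator1.lean`), PROVED.

Setting: `(A, 𝔪)` a regular local ring of characteristic `p`, `u, y ∈ 𝔪` part of a regular
system of parameters (rendered: `A ⧸ (u, y)` regular of dimension `dim A − 2`), `m ≥ 1`.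
`A₁ = A[T]/(T^p − u^{p−1}T − u)` is the Artin–Schreier SHADOW of `u^{1/p}` and
`A₂ = A₁[W]/(W^p − T^{m(p−1)} W − y·η^m)`, `η = 1 + u^{p−2}T`, is the ferocious normal form of the
layer `z^p − z = y/u^m`. Claim: `A₂` is a regular ring.

Proof (generator count, twice). The engine is `isRegularLocalRing_adjoinRoot_trinomial`: for a
regular local `(A, 𝔪)` of dimension `m + 1` with `𝔪 = (y, x₁, …, x_m)`, any `a ∈ 𝔪` and `n ≥ 2`,
the ring `B = A[Z]/(Z^n − aZ − y)` is finite free over `A`; every maximal ideal of `B` lies over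
`𝔪` and contains `z` (as `z^n = a z + y`), while `B/(𝔪, z) = A/𝔪` is a field, so `B` is local
with maximal ideal `(𝔪, z) = (z, x₁, …, x_m)` (because `y = z^n − a z ∈ (z)`): `m + 1` generators
against `dim B = dim A = m + 1` (integral injective extension), hence `B` is regular local. Apply it
to `A ⊂ A₁` (parameter `u`, `a = u^{p−1}`; new parameters `(t, y, x₃, …)`) and to `A₁ ⊂ A₂`
(parameter `y·η^m` — `η` is a unit — and `a = t^{m(p−1)} ∈ 𝔪₁` since `m ≥ 1`); finally a regular
local ring is a regular ring (Serre, `isRegularLocalRing_localization_atPrime`). The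
characteristic-`p` hypothesis is not needed for regularity (it governs the Galois/étale reading).

Pattern: `Literature.AlgebraicGeometry.Resolution.AdjoinRoot.isRegularLocalRing_X_pow_sub_C`
(`RootAdjunctionRegular.lean`, the case `a = 0`).

## References
* H. Matsumura, *Commutative Ring Theory* (1986), Thm. 9.4, Thm. 14.2, Thm. 19.3. [Matsumura1987]
-/

noncomputable section

set_option linter.dupNamespace false -- mandated namespace of this single-conjunct summit

open IsLocalRing Polynomial

namespace Summit.ResolutionOfSingularities.ResolutionOfSingularities.Theorems.GaloisQuotientModels.FerociousEnlargement

universe u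

variable {A : Type u} [CommRing A]

/-! ## The trinomial `Z^n − a Z − y` -/

/-- `Z^n − aZ − y` is monic for `n ≥ 2`. [folklore] -/
theorem monic_trinomial (a y : A) {n : ℕ} (hn : 2 ≤ n) :
    (X ^ n - C a * X - C y : A[X]).Monic := by
  rw [sub_sub]
  refine monic_X_pow_sub ?_
  refine lt_of_le_of_lt (degree_add_le _ _) (max_lt ?_ ?_)
  · exact (degree_C_mul_X_le a).trans_lt (by exact_mod_cast (show 1 < n by omega))
  · exact degree_C_le.trans_lt (by exact_mod_cast (show 0 < n by omega))

/-- `Z^n − aZ − y` has degree `n` over a nontrivial ring (`n ≥ 2`). [folklore] -/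
theorem degree_trinomial [Nontrivial A] (a y : A) {n : ℕ} (hn : 2 ≤ n) :
    (X ^ n - C a * X - C y : A[X]).degree = n := by
  rw [sub_sub, degree_sub_eq_left_of_degree_lt, degree_X_pow]
  rw [degree_X_pow]
  refine lt_of_le_of_lt (degree_add_le _ _) (max_lt ?_ ?_)
  · exact (degree_C_mul_X_le a).trans_lt (by exact_mod_cast (show 1 < n by omega))
  · exact degree_C_le.trans_lt (by exact_mod_cast (show 0 < n by omega))

/-- The defining relation `z^n = a z + y` in `A[Z]/(Z^n − aZ − y)`. [folklore] -/
theorem root_trinomial_pow (a y : A) (n : ℕ) :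
    AdjoinRoot.root (X ^ n - C a * X - C y : A[X]) ^ n =
      AdjoinRoot.of (X ^ n - C a * X - C y : A[X]) a * AdjoinRoot.root (X ^ n - C a * X - C y : A[X]) +
        AdjoinRoot.of (X ^ n - C a * X - C y : A[X]) y := by
  have h := AdjoinRoot.eval₂_root (X ^ n - C a * X - C y : A[X])
  rw [eval₂_sub, eval₂_sub, eval₂_X_pow, eval₂_mul, eval₂_C, eval₂_X, eval₂_C] at h
  linear_combination h

section Local

variable [IsLocalRing A] (a y : A) {n : ℕ}

/-- **`B = A[Z]/(Z^n − aZ − y)` is local** with maximal ideal `𝔪B + (z)` when `a, y ∈ 𝔪` and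
`n ≥ 2`: the point `Z ↦ 0` gives a surjection `B → A/𝔪` with kernel `𝔪B + (z)`, which is
therefore maximal; every maximal ideal of the integral extension `B` lies over `𝔪` and contains
`z` (as `z^n = a z + y ∈ 𝔪B`). [folklore] -/
theorem isLocalRing_adjoinRoot_trinomial (hn : 2 ≤ n) (ha : a ∈ maximalIdeal A)
    (hy : y ∈ maximalIdeal A) :
    ∃ _ : IsLocalRing (AdjoinRoot (X ^ n - C a * X - C y : A[X])),
      maximalIdeal (AdjoinRoot (X ^ n - C a * X - C y : A[X])) =
        (maximalIdeal A).map (AdjoinRoot.of (X ^ n - C a * X - C y : A[X])) ⊔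
          Ideal.span {AdjoinRoot.root (X ^ n - C a * X - C y : A[X])} := by
  set g : A[X] := X ^ n - C a * X - C y with hg
  have hmon : g.Monic := monic_trinomial a y hn
  haveI : Module.Finite A (AdjoinRoot g) := hmon.finite_adjoinRoot
  haveI : Algebra.IsIntegral A (AdjoinRoot g) := inferInstance
  -- the `k`-point `Z ↦ 0`
  have hev : eval₂ (residue A) 0 g = 0 := by
    rw [hg, eval₂_sub, eval₂_sub, eval₂_X_pow, eval₂_mul, eval₂_C, eval₂_X, eval₂_C, mul_zero,
      sub_zero, zero_pow (by omega), zero_sub, neg_eq_zero, residue_eq_zero_iff]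
    exact hy
  let φ : AdjoinRoot g →+* ResidueField A := AdjoinRoot.lift (residue A) 0 hev
  have hφof : ∀ b : A, φ (AdjoinRoot.of g b) = residue A b := fun b => AdjoinRoot.lift_of hev
  have hφroot : φ (AdjoinRoot.root g) = 0 := AdjoinRoot.lift_root hev
  have hφsurj : Function.Surjective φ := fun r => by
    obtain ⟨b, rfl⟩ := residue_surjective r
    exact ⟨AdjoinRoot.of g b, hφof b⟩
  -- its kernel is `𝔪B + (z)`
  set I : Ideal (AdjoinRoot g) :=
    (maximalIdeal A).map (AdjoinRoot.of g) ⊔ Ideal.span {AdjoinRoot.root g} with hI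
  have hker : RingHom.ker φ = I := by
    apply le_antisymm
    · intro b hb
      induction b using AdjoinRoot.induction_on with
      | ih q =>
        have hq : AdjoinRoot.mk g q =
            AdjoinRoot.root g * AdjoinRoot.mk g q.divX + AdjoinRoot.of g (q.coeff 0) := by
          conv_lhs => rw [← Polynomial.X_mul_divX_add q]
          rw [map_add, map_mul, AdjoinRoot.mk_X, AdjoinRoot.mk_C]
        rw [RingHom.mem_ker, hq, map_add, map_mul, hφroot, zero_mul, zero_add, hφof,
          residue_eq_zero_iff] at hb
        rw [hq]
        exact Ideal.add_mem _
          (Ideal.mem_sup_right (Ideal.mul_mem_right _ _ (Ideal.subset_span rfl)))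
          (Ideal.mem_sup_left (Ideal.mem_map_of_mem _ hb))
    · refine sup_le ?_ ?_
      · rw [Ideal.map_le_iff_le_comap]
        intro b hb
        rw [Ideal.mem_comap, RingHom.mem_ker, hφof, residue_eq_zero_iff]
        exact hb
      · rw [Ideal.span_le, Set.singleton_subset_iff, SetLike.mem_coe, RingHom.mem_ker]
        exact hφroot
  have hmax : I.IsMaximal := hker ▸ RingHom.ker_isMaximal_of_surjective φ hφsurj
  -- every maximal ideal is `I`
  have huniq : ∀ 𝔫 : Ideal (AdjoinRoot g), 𝔫.IsMaximal → 𝔫 = I := by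
    intro 𝔫 h𝔫
    refine (hmax.eq_of_le h𝔫.ne_top ?_).symm
    have hc : 𝔫.comap (algebraMap A (AdjoinRoot g)) = maximalIdeal A := by
      haveI : (𝔫.comap (algebraMap A (AdjoinRoot g))).IsMaximal :=
        Ideal.isMaximal_comap_of_isIntegral_of_isMaximal 𝔫
      exact IsLocalRing.eq_maximalIdeal inferInstance
    have hmap : (maximalIdeal A).map (AdjoinRoot.of g) ≤ 𝔫 := by
      rw [Ideal.map_le_iff_le_comap, ← AdjoinRoot.algebraMap_eq, hc]
    refine sup_le hmap ?_
    rw [Ideal.span_le, Set.singleton_subset_iff, SetLike.mem_coe]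
    apply h𝔫.isPrime.mem_of_pow_mem n
    rw [root_trinomial_pow]
    exact Ideal.add_mem _ (Ideal.mul_mem_right _ _ (hmap (Ideal.mem_map_of_mem _ ha)))
      (hmap (Ideal.mem_map_of_mem _ hy))
  haveI : IsLocalRing (AdjoinRoot g) := IsLocalRing.of_unique_max_ideal ⟨_, hmax, huniq⟩
  exact ⟨inferInstance, huniq _ (maximalIdeal.isMaximal _)⟩

end Local

/-- **Adjoining a root of `Z^n − aZ − y`, `a ∈ 𝔪`, `y` a regular parameter, keeps a local ring
regular.** For a regular local ring `A` of dimension `m + 1` with `𝔪 = (y, x₁, …, x_m)`, `a ∈ 𝔪`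
and `n ≥ 2`, `B = A[Z]/(Z^n − aZ − y)` is a regular local ring of dimension `m + 1` with maximal
ideal `(z, x₁, …, x_m)`, and `A → B` is injective. (Generator count: `y = z^n − a z ∈ (z)`, so
`𝔪_B = 𝔪B + (z)` needs `m + 1 = dim B` generators.) [cite: Matsumura1987, Thm. 14.2] -/
theorem isRegularLocalRing_adjoinRoot_trinomial [IsRegularLocalRing A] {m : ℕ} (x : Fin m → A)
    (a y : A) (ha : a ∈ maximalIdeal A)
    (hgen : Ideal.span (insert y (Set.range x)) = maximalIdeal A)
    (hdim : ringKrullDim A = m + 1) {n : ℕ} (hn : 2 ≤ n) :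
    ∃ _ : IsLocalRing (AdjoinRoot (X ^ n - C a * X - C y : A[X])),
      IsRegularLocalRing (AdjoinRoot (X ^ n - C a * X - C y : A[X])) ∧
      ringKrullDim (AdjoinRoot (X ^ n - C a * X - C y : A[X])) = m + 1 ∧
      maximalIdeal (AdjoinRoot (X ^ n - C a * X - C y : A[X])) =
        Ideal.span (insert (AdjoinRoot.root (X ^ n - C a * X - C y : A[X]))
          (Set.range (AdjoinRoot.of (X ^ n - C a * X - C y : A[X]) ∘ x))) ∧
      Function.Injective (algebraMap A (AdjoinRoot (X ^ n - C a * X - C y : A[X]))) := by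
  set g : A[X] := X ^ n - C a * X - C y with hg
  have hmon : g.Monic := monic_trinomial a y hn
  haveI : Module.Finite A (AdjoinRoot g) := hmon.finite_adjoinRoot
  haveI : Algebra.IsIntegral A (AdjoinRoot g) := inferInstance
  have hy : y ∈ maximalIdeal A := hgen ▸ Ideal.subset_span (Set.mem_insert _ _)
  obtain ⟨hloc, hmaxeq⟩ := isLocalRing_adjoinRoot_trinomial a y hn ha hy
  haveI := hloc
  -- injectivity and dimension
  haveI : IsDomain A := Literature.AlgebraicGeometry.Resolution.isDomain_of_isRegularLocalRing A
  have hinj : Function.Injective (algebraMap A (AdjoinRoot g)) :=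
    AdjoinRoot.of.injective_of_degree_ne_zero (by
      rw [hg, degree_trinomial a y hn]; exact_mod_cast (show n ≠ 0 by omega))
  have hdimB : ringKrullDim (AdjoinRoot g) = m + 1 := by
    rw [← Literature.RingTheory.KrullDimension.ringKrullDim_eq_of_isIntegral hinj, hdim]
  -- the maximal ideal
  have hz : AdjoinRoot.of g y =
      AdjoinRoot.root g ^ n - AdjoinRoot.of g a * AdjoinRoot.root g := by
    rw [hg, root_trinomial_pow]; ring
  have hmax' : maximalIdeal (AdjoinRoot g) =
      Ideal.span (insert (AdjoinRoot.root g) (Set.range (AdjoinRoot.of g ∘ x))) := by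
    rw [hmaxeq, ← hgen, Ideal.map_span]
    apply le_antisymm
    · refine sup_le (Ideal.span_le.mpr ?_) (Ideal.span_le.mpr ?_)
      · rintro _ ⟨b, hb, rfl⟩
        rcases Set.mem_insert_iff.mp hb with rfl | ⟨i, rfl⟩
        · change AdjoinRoot.of g b ∈ _
          rw [hz]
          have hr : AdjoinRoot.root g ∈
              Ideal.span (insert (AdjoinRoot.root g) (Set.range (AdjoinRoot.of g ∘ x))) :=
            Ideal.subset_span (Set.mem_insert _ _)
          exact Ideal.sub_mem _ (Ideal.pow_mem_of_mem _ hr n (by omega))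
            (Ideal.mul_mem_left _ _ hr)
        · exact Ideal.subset_span (Set.mem_insert_of_mem _ ⟨i, rfl⟩)
      · rintro _ rfl
        exact Ideal.subset_span (Set.mem_insert _ _)
    · refine Ideal.span_le.mpr ?_
      rintro _ hb
      rcases Set.mem_insert_iff.mp hb with rfl | ⟨i, rfl⟩
      · exact Ideal.mem_sup_right (Ideal.subset_span rfl)
      · exact Ideal.mem_sup_left (Ideal.subset_span ⟨x i, Set.mem_insert_of_mem _ ⟨i, rfl⟩, rfl⟩)
  -- regularity: `𝔪_B` has `≤ m + 1 = dim B` generators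
  have hreg : IsRegularLocalRing (AdjoinRoot g) := by
    classical
    haveI : IsNoetherianRing (AdjoinRoot g) := inferInstance
    refine IsRegularLocalRing.of_spanFinrank_maximalIdeal_le (R := AdjoinRoot g) ?_
    rw [hdimB, hmax']
    have hS : (insert (AdjoinRoot.root g) (Set.range (AdjoinRoot.of g ∘ x))) =
        ↑(insert (AdjoinRoot.root g) (Finset.univ.image (AdjoinRoot.of g ∘ x))) := by
      ext b; simp
    have hfin : (insert (AdjoinRoot.root g) (Set.range (AdjoinRoot.of g ∘ x))).Finite := by
      rw [hS]; exact Finset.finite_toSet _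
    have h1 := Submodule.spanFinrank_span_le_ncard_of_finite (R := AdjoinRoot g) hfin
    have h2 : (insert (AdjoinRoot.root g) (Set.range (AdjoinRoot.of g ∘ x))).ncard ≤ m + 1 := by
      rw [hS, Set.ncard_coe_finset]
      calc (insert (AdjoinRoot.root g) (Finset.univ.image (AdjoinRoot.of g ∘ x))).card
          ≤ (Finset.univ.image (AdjoinRoot.of g ∘ x)).card + 1 := Finset.card_insert_le _ _
        _ ≤ m + 1 := by
          have := Finset.card_image_le (s := Finset.univ) (f := AdjoinRoot.of g ∘ x)
          rw [Finset.card_univ, Fintype.card_fin] at this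
          omega
    exact_mod_cast h1.trans h2
  exact ⟨hloc, hreg, hdimB, hmax', hinj⟩

/-! ## Regular parameters of `A` from a regular quotient `A ⧸ (u, y)` of dimension `dim A − 2` -/

/-- If `A ⧸ (u, y)` is a regular local ring of dimension `dim A − 2` (and `u, y ∈ 𝔪`), then
`𝔪 = (u, y, x₁, …, x_e)` for some `x` with `dim A = e + 2`: lift a minimal system of generators of
the maximal ideal of the quotient. [cite: Matsumura1987, Thm. 14.2] -/
theorem exists_generators_of_quotient_pair [IsLocalRing A] [IsNoetherianRing A] (u y : A)
    (hu : u ∈ maximalIdeal A) (hy : y ∈ maximalIdeal A)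
    (hpar : IsRegularLocalRing (A ⧸ Ideal.span ({u, y} : Set A)))
    (hdim : ringKrullDim (A ⧸ Ideal.span ({u, y} : Set A)) + 2 = ringKrullDim A) :
    ∃ (e : ℕ) (x : Fin e → A),
      Ideal.span (insert u (insert y (Set.range x))) = maximalIdeal A ∧
      ringKrullDim A = e + 2 := by
  classical
  set I : Ideal A := Ideal.span ({u, y} : Set A) with hI
  haveI := hpar
  obtain ⟨s, hscard, hsspan⟩ := Submodule.FG.exists_span_finset_card_eq_spanFinrank
    (p := maximalIdeal (A ⧸ I)) (IsNoetherian.noetherian _)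
  have hdimQ : ringKrullDim (A ⧸ I) = (s.card : WithBot ℕ∞) := by
    rw [hscard]; exact (IsRegularLocalRing.spanFinrank_maximalIdeal (R := A ⧸ I)).symm
  -- lift the generators
  have hmk : Function.Surjective (Ideal.Quotient.mk I) := Ideal.Quotient.mk_surjective
  choose x hx using fun i : Fin s.card => hmk (s.equivFin.symm i : A ⧸ I)
  refine ⟨s.card, x, ?_, ?_⟩
  · -- comparison of `𝔪_A` with the lifted generators
    have hcomap : (maximalIdeal (A ⧸ I)).comap (Ideal.Quotient.mk I) = maximalIdeal A := by
      haveI : ((maximalIdeal (A ⧸ I)).comap (Ideal.Quotient.mk I)).IsMaximal :=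
        Ideal.comap_isMaximal_of_surjective _ hmk
      exact IsLocalRing.eq_maximalIdeal inferInstance
    have hsspan' : Ideal.span (s : Set (A ⧸ I)) = maximalIdeal (A ⧸ I) := hsspan
    have hrange : Set.range (fun i => (Ideal.Quotient.mk I) (x i)) = (s : Set (A ⧸ I)) := by
      ext b
      simp only [Set.mem_range, Finset.mem_coe, hx]
      constructor
      · rintro ⟨i, rfl⟩
        exact (s.equivFin.symm i).2
      · intro hb
        exact ⟨s.equivFin ⟨b, hb⟩, by simp⟩
    apply le_antisymm
    · rw [Ideal.span_le]
      intro b hb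
      rcases Set.mem_insert_iff.mp hb with rfl | hb
      · exact hu
      rcases Set.mem_insert_iff.mp hb with rfl | ⟨i, rfl⟩
      · exact hy
      · change x i ∈ maximalIdeal A
        have hmem : Ideal.Quotient.mk I (x i) ∈ (s : Set (A ⧸ I)) := by
          rw [← hrange]; exact ⟨i, rfl⟩
        rw [← hcomap, Ideal.mem_comap, ← hsspan']
        exact Ideal.subset_span hmem
    · intro z hz
      have hz' : Ideal.Quotient.mk I z ∈ (Ideal.span (Set.range x)).map (Ideal.Quotient.mk I) := by
        rw [Ideal.map_span, ← Set.range_comp]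
        change _ ∈ Ideal.span (Set.range fun i => Ideal.Quotient.mk I (x i))
        rw [hrange, hsspan', ← Ideal.mem_comap, hcomap]
        exact hz
      rw [← Ideal.mem_comap, Ideal.comap_map_of_surjective _ hmk, ← RingHom.ker_eq_comap_bot,
        Ideal.mk_ker] at hz'
      refine (?_ : Ideal.span (Set.range x) ⊔ I ≤ _) hz'
      refine sup_le (Ideal.span_mono fun b hb => ?_) ?_
      · exact Set.mem_insert_of_mem _ (Set.mem_insert_of_mem _ hb)
      · change Ideal.span ({u, y} : Set A) ≤ _
        rw [Ideal.span_le]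
        rintro b hb
        rcases hb with rfl | rfl
        · exact Ideal.subset_span (Set.mem_insert _ _)
        · exact Ideal.subset_span (Set.mem_insert_of_mem _ (Set.mem_insert _ _))
  · rw [← hdim, hdimQ]

/-! ## The stub -/

/-- **Stub `stub_ferocify`** (card `ferocious-enlargement`, first lemma; registered signature of
`Cruxes/GaloisQuotientModels/SketchIdeator1.lean`). `A` regular local of characteristic `p`,
`u, y ∈ 𝔪` with `A ⧸ (u, y)` regular of dimension `dim A − 2`, `m ≥ 1`;
`A₁ = A[T]/(T^p − u^{p−1}T − u)` (the Artin–Schreier shadow of `u^{1/p}`),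
`η = 1 + u^{p−2}T`, `A₂ = A₁[W]/(W^p − T^{m(p−1)}W − y η^m)` (ferocious normal form of
`z^p − z = y/u^m`, `W = zT^m`). Then `A₂` is a regular ring. Proof: two applications of
`isRegularLocalRing_adjoinRoot_trinomial` (`𝔪_{A₁} = (t, y, x…)`, `𝔪_{A₂} = (w, t, x…)`, `η` a
unit) and Serre's theorem that a regular local ring is regular. [cite: Matsumura1987, Thm. 14.2] -/
theorem stub_ferocify (p : ℕ) [Fact p.Prime] (A : Type) [CommRing A] [IsRegularLocalRing A]
    [CharP A p] (u y : A) (hu : u ∈ maximalIdeal A) (hy : y ∈ maximalIdeal A)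
    (hpar : IsRegularLocalRing (A ⧸ Ideal.span ({u, y} : Set A)))
    (hdim : ringKrullDim (A ⧸ Ideal.span ({u, y} : Set A)) + 2 = ringKrullDim A)
    (m : ℕ) (hm : 0 < m) :
    let g : A[X] := X ^ p - C (u ^ (p - 1)) * X - C u
    let A₁ := AdjoinRoot g
    let t : A₁ := AdjoinRoot.root g
    let η : A₁ := 1 + algebraMap A A₁ (u ^ (p - 2)) * t
    let h : A₁[X] := X ^ p - C (t ^ (m * (p - 1))) * X - C (algebraMap A A₁ y * η ^ m)
    IsRegularRing (AdjoinRoot h) := by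
  intro g A₁ t η h
  have hp2 : 2 ≤ p := (Fact.out : p.Prime).two_le
  -- generators `𝔪_A = (u, y, x₁, …, x_e)`, `dim A = e + 2`
  obtain ⟨e, x, hgen, hdimA⟩ := exists_generators_of_quotient_pair u y hu hy hpar hdim
  -- Step 1: `A₁` is regular local with `𝔪₁ = (t, y, x…)`
  have hgen₁ : Ideal.span (insert u (Set.range (Fin.cons y x : Fin (e + 1) → A))) =
      maximalIdeal A := by
    rw [Fin.range_cons, hgen]
  have hdimA' : ringKrullDim A = ↑(e + 1) + 1 := by
    rw [hdimA]; push_cast; rw [add_assoc, one_add_one_eq_two]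
  have ha₁ : u ^ (p - 1) ∈ maximalIdeal A :=
    Ideal.pow_mem_of_mem _ hu _ (by omega)
  obtain ⟨hloc₁, hreg₁, hdim₁, hmax₁, -⟩ :=
    isRegularLocalRing_adjoinRoot_trinomial (Fin.cons y x) (u ^ (p - 1)) u ha₁ hgen₁ hdimA' hp2
  haveI := hloc₁
  haveI := hreg₁
  -- Step 2: `A₂` over `A₁`, parameter `y η^m`, `a = t^{m(p-1)} ∈ 𝔪₁`
  have ht : t ∈ maximalIdeal A₁ := by
    change AdjoinRoot.root g ∈ _
    rw [hmax₁]
    exact Ideal.subset_span (Set.mem_insert _ _)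
  have ha₂ : t ^ (m * (p - 1)) ∈ maximalIdeal A₁ :=
    Ideal.pow_mem_of_mem _ ht _ (Nat.mul_pos hm (by omega))
  have hct : algebraMap A A₁ (u ^ (p - 2)) * t ∈ maximalIdeal A₁ := Ideal.mul_mem_left _ _ ht
  have hηunit : IsUnit η := by
    rcases IsLocalRing.isUnit_or_isUnit_one_sub_self (-(algebraMap A A₁ (u ^ (p - 2)) * t))
      with h1 | h1
    · exact absurd h1 ((IsLocalRing.mem_maximalIdeal _).mp ((Submodule.neg_mem_iff _).mpr hct))
    · rw [sub_neg_eq_add] at h1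
      exact h1
  -- new generator family over `A₁`: `(t, x₁, …, x_e)` together with the parameter `y η^m`
  set x₁ : Fin (e + 1) → A₁ := Fin.cons t (AdjoinRoot.of g ∘ x) with hx₁
  have hgen₂ : Ideal.span (insert (algebraMap A A₁ y * η ^ m) (Set.range x₁)) =
      maximalIdeal A₁ := by
    have hηm : IsUnit (η ^ m) := hηunit.pow m
    rw [Ideal.span_insert, Ideal.span_singleton_mul_right_unit hηm, ← Ideal.span_insert, hmax₁]
    congr 1
    simp only [hx₁, Fin.range_cons, Set.range_comp, Set.image_insert_eq]
    rw [Set.insert_comm]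
    rfl
  obtain ⟨hloc₂, hreg₂, -, -, -⟩ :=
    isRegularLocalRing_adjoinRoot_trinomial x₁ (t ^ (m * (p - 1))) (algebraMap A A₁ y * η ^ m)
      ha₂ hgen₂ hdim₁ hp2
  haveI := hloc₂
  haveI := hreg₂
  exact isRegularRing_iff.mpr fun P _ =>
    Literature.AlgebraicGeometry.Resolution.isRegularLocalRing_localization_atPrime _ P

end Summit.ResolutionOfSingularities.ResolutionOfSingularities.Theorems.GaloisQuotientModels.FerociousEnlargement

end
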